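import Summits.AtomisticToContinuum.BoseEinsteinCondensation.Theorems.BECGroundStateSOSPeriodicIRBoundFsumNormalisationBootstrap
import Summits.AtomisticToContinuum.BoseEinsteinCondensation.Theorems.BECGroundStateSOSPeriodicIRBoundFsumDoubleCommutator
import Summits.AtomisticToContinuum.BoseEinsteinCondensation.Theorems.BECGroundStateSOSPeriodicIRBoundFsumBackflowOfStatic
import Summits.AtomisticToContinuum.BoseEinsteinCondensation.Theorems.BECGroundStateSOSPeriodicIRBoundFsumDCKinetic
import HarnessLib

/-!
# Crux `PeriodicIRBound` (stmt-AtomisticToContinuum-3972), line `fsum-phase-pencil` — the standing REDUCTION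

With S2 (`stub_phaseConeBlock`, p125841), S3 (`stub_phaseDoubleCommutator`, p129428) and S5
(`stub_normalisationBootstrap`) LANDED, the skeleton `Cruxes/PeriodicIRBound/Lines/fsum_phase_pencil.lean` proves
the crux BY NAME from exactly four named statements of `Theorems/BECGroundStateSOSPeriodicIRBoundFsumDefs.lean`:

* S1 `BackflowBound` — the LOAD (implied by the static current bound `StaticBackflowCurrent`,
  `stub_backflowOfStatic`, p128588);
* S4 `CondensateDensityQuadrature` — the condensate-leg density quadrature is not enhanced (`‖P_kΨ‖² ≤ CN`);
* S5a `CondensateNumberVariance` — no cat (`Var_Ψ(n̂₀) ≤ C N` uniformly over each class);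
* S6 `NonIntegrableHalf` — the crux on the hard-core sub-class (not reduced by the line).

This file records that reduction as importable tree theorems (the condensate-leg twin of the sibling line's
`Theorems/BECGroundStateSOSPeriodicIRBoundReductionIntegrable.lean`, whose open inputs are stmt-9091 ∧ stmt-9094):

* `weightedClassBound_of_open_inputs` — S1 ∧ S4 ⇒ `WeightedClassBound R₀ V₁` for every class;
* `irBoundFor_integrable_of_open_inputs` — S1 ∧ S4 ∧ S5a ⇒ `IRBoundFor v` for every INTEGRABLE admissible `v`;
* `irBoundFor_integrable_of_static` — the same from `StaticBackflowCurrent` in place of S1;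
* `periodicIRBound_of_open_inputs` — S1 ∧ S4 ∧ S5a ∧ S6 ⇒ the crux `PeriodicIRBound` BY NAME;
* the RESHAPE of S4 into the strictly weaker S4′ `CondensatePairingSign` (`Re⟨T_{k0}Ψ, T_{0,−k}Ψ⟩ ≤ CN + ε`, the
  sign of the condensate pairing amplitude; §4 of the Defs module): `condensatePairingSign_of_densityQuadrature`
  (S4 ⇒ S4′), `weightedClassBound_of_pairingSign` (S1 ∧ S4′ ⇒ weighted class bound — the phase quadrature alone
  recovers `‖T_{k0}Ψ‖² + ‖T_{0,−k}Ψ‖²`), `irBoundFor_integrable_of_pairingSign`, `periodicIRBound_of_pairingSign`;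
* `stub_fsumReduction` — the registered by-product sub-goal (the conjunction of the S4′ shapes).
-/

noncomputable section

open MeasureTheory Filter
open scoped ENNReal NNReal ComplexConjugate BigOperators

namespace Summit.AtomisticToContinuum.BoseEinsteinCondensation.Cruxes.PeriodicIRBound.FsumPhasePencil

open Literature.MathematicalPhysics.QuantumManyBody.BoseGas
open Summit.AtomisticToContinuum.BoseEinsteinCondensation.Theses.BECGroundStateSOS (PeriodicIRBound)
open Summit.AtomisticToContinuum.BoseEinsteinCondensation.Theorems.PeriodicIRBound.Negative
  (NearMin InWindow IRBoundFor periodicIRBound_iff)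
open Summit.AtomisticToContinuum.BoseEinsteinCondensation.Theorems.GaussianDominationCan.Negative
  (one_le_norm_intVec)
open Summit.AtomisticToContinuum.BoseEinsteinCondensation.Cruxes.PeriodicIRBound.LinearPhFloorWagner.WF
  (qform normSq IsCore formRe innerRe)

/-! ## Arithmetic of the composition (copied from the skeleton, where it is kernel-checked since the crux-plan) -/

section Lemmas

variable {N : ℕ}

/-- Monotonicity of the near-minimiser property in the slack. [folklore] -/
theorem nearMin_mono_red {w : ℝ → ℝ≥0∞} {ρ : ℝ} {δ δ' : ℝ≥0∞} {Ψ : PeriodicTrialState N (sideLength ρ N)}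
    (h : NearMin w ρ N δ Ψ) (hδ : δ ≤ δ') : NearMin w ρ N δ' Ψ :=
  le_trans (show periodicEnergy w Ψ ≤ _ from h) (add_le_add le_rfl hδ)

/-- Quadratic inequality: `a y² ≤ b y + c` with `a > 0` gives `y² ≤ (b/a)² + 2c/a`. [folklore] -/
theorem sq_le_of_quadratic_red {a b c y : ℝ} (ha : 0 < a) (h : a * y ^ 2 ≤ b * y + c) :
    y ^ 2 ≤ (b / a) ^ 2 + 2 * c / a := by
  have h1 : a ^ 2 * y ^ 2 ≤ b ^ 2 + 2 * a * c := by
    nlinarith [sq_nonneg (a * y - b), mul_le_mul_of_nonneg_left h ha.le]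
  rw [div_pow, div_add_div _ _ (pow_ne_zero 2 ha.ne') ha.ne', le_div_iff₀ (by positivity)]
  nlinarith [h1, ha]

/-- The sup norm of an integer vector is at most its Euclidean norm. [folklore] -/
theorem norm_intVec_le_norm_latticeVec_red (k : Fin 3 → ℤ) :
    ‖(fun j => (k j : ℝ))‖ ≤ ‖latticeVec 1 k‖ := by
  refine (pi_norm_le_iff_of_nonneg (norm_nonneg _)).2 fun j => ?_
  rw [EuclideanSpace.norm_eq]
  refine Real.le_sqrt_of_sq_le ?_
  have : ‖(k j : ℝ)‖ ^ 2 = ‖(latticeVec 1 k) j‖ ^ 2 := by simp [latticeVec]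
  rw [this]
  exact Finset.single_le_sum (f := fun i => ‖(latticeVec 1 k) i‖ ^ 2) (fun i _ => by positivity)
    (Finset.mem_univ j)

/-- `‖k̃‖ = (2π/L)·|k|₂` (via the landed `waveVector_eq_smul`). [folklore] -/
theorem norm_waveVector_red {L : ℝ} (hL : 0 < L) (k : Fin 3 → ℤ) :
    ‖waveVector L k‖ = 2 * Real.pi / L * ‖latticeVec 1 k‖ := by
  rw [waveVector_eq_smul, norm_smul, Real.norm_of_nonneg (by positivity)]

/-- `k ≠ 0 ⇒ ‖k̃‖ > 0`. [folklore] -/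
theorem norm_waveVector_pos_red {L : ℝ} (hL : 0 < L) {k : Fin 3 → ℤ} (hk : k ≠ 0) :
    0 < ‖waveVector L k‖ := by
  rw [norm_waveVector_red hL]
  refine mul_pos (by positivity) (norm_pos_iff.2 fun h => hk ?_)
  funext j
  have := congrArg (fun x : Space => x j) h
  simpa [latticeVec] using this

/-- The window conversion `2π‖k‖_∞/L ≤ ‖k̃‖`. [folklore] -/
theorem two_pi_mul_norm_div_le_norm_waveVector_red {L : ℝ} (hL : 0 < L) (k : Fin 3 → ℤ) :
    2 * Real.pi * ‖(fun j => (k j : ℝ))‖ / L ≤ ‖waveVector L k‖ := by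
  rw [norm_waveVector_red hL, mul_div_right_comm]
  exact mul_le_mul_of_nonneg_left (norm_intVec_le_norm_latticeVec_red k) (by positivity)

/-- **The composition algebra** (the card's `PhaseExtraction`): a quadratic inequality in `y = ‖U_kΨ‖` absorbs
the backflow term carrying `y`. Inputs: S1 (`h1`), S2 (`h2`), S3 (`h3`), S4 (`h4`), the two window conversions.
Output: `‖U‖² + ‖P‖² ≤ C_w N√ρL/‖k‖_∞`. [folklore] -/
theorem weighted_algebra_red {N ρ kk L kinf κ C₁ C₃ C₄ μ nu np Q : ℝ}
    (hN : 1 ≤ N) (hρ : 0 < ρ) (hkk : 0 < kk) (hL : 0 < L) (hkinf : 0 < kinf) (hκ : 0 < κ)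
    (hC₁ : 0 < C₁) (hC₃ : 0 < C₃) (hC₄ : 0 < C₄) (hnu : 0 ≤ nu)
    (hwin1 : kinf ≤ κ * Real.sqrt ρ * L)
    (hwin2 : 2 * Real.pi * kinf / L ≤ kk)
    (h1 : |μ - kk ^ 2 * nu| ≤
      C₁ * (N * Real.sqrt ρ * kk + Real.sqrt N * kk ^ 2 * Real.sqrt nu) + N * Real.sqrt ρ * kk)
    (h2 : |μ| ≤ Real.sqrt (Q * (2 * N * kk ^ 2 + N * kk ^ 2)) + N * kk ^ 2)
    (h3 : Q ≤ C₃ * N * (kk ^ 2 + ρ) + N * ρ)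
    (h4 : np ≤ C₄ * N + N) :
    nu + np ≤ ((2 * C₁ ^ 2 + 2 * Real.sqrt (3 * (C₃ + 1)) + 3 + C₄) * κ +
        (2 * Real.sqrt (3 * (C₃ + 1)) + 2 * C₁ + 2) / (2 * Real.pi)) * N * Real.sqrt ρ * L / kinf := by
  set A : ℝ := Real.sqrt (3 * (C₃ + 1)) with hA_def
  have hA : 0 ≤ A := Real.sqrt_nonneg _
  have hNpos : 0 < N := by linarith
  have hsρ : 0 < Real.sqrt ρ := Real.sqrt_pos.2 hρ
  have hsN : 0 < Real.sqrt N := Real.sqrt_pos.2 hNpos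
  have hsqrt : Real.sqrt (Q * (2 * N * kk ^ 2 + N * kk ^ 2)) ≤ A * N * kk * (kk + Real.sqrt ρ) := by
    have h3' : Q * (2 * N * kk ^ 2 + N * kk ^ 2) ≤ (A * N * kk * (kk + Real.sqrt ρ)) ^ 2 := by
      have hpos : 0 ≤ 2 * N * kk ^ 2 + N * kk ^ 2 := by positivity
      have := mul_le_mul_of_nonneg_right h3 hpos
      have hA2 : A ^ 2 = 3 * (C₃ + 1) := by
        rw [hA_def, Real.sq_sqrt (by positivity)]
      have hρ2 : Real.sqrt ρ ^ 2 = ρ := Real.sq_sqrt hρ.le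
      have hstep1 : (C₃ * N * (kk ^ 2 + ρ) + N * ρ) * (2 * N * kk ^ 2 + N * kk ^ 2) ≤
          3 * (C₃ + 1) * N ^ 2 * kk ^ 2 * (kk ^ 2 + ρ) := by
        have : (C₃ * N * (kk ^ 2 + ρ) + N * ρ) ≤ (C₃ + 1) * N * (kk ^ 2 + ρ) := by
          nlinarith [mul_nonneg hNpos.le (sq_nonneg kk)]
        nlinarith [this, hpos]
      have hstep2 : kk ^ 2 + ρ ≤ (kk + Real.sqrt ρ) ^ 2 := by
        nlinarith [hρ2, mul_nonneg hkk.le hsρ.le]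
      have hstep3 : 3 * (C₃ + 1) * N ^ 2 * kk ^ 2 * (kk ^ 2 + ρ) ≤
          3 * (C₃ + 1) * N ^ 2 * kk ^ 2 * (kk + Real.sqrt ρ) ^ 2 :=
        mul_le_mul_of_nonneg_left hstep2 (by positivity)
      have hsq : (A * N * kk * (kk + Real.sqrt ρ)) ^ 2 =
          3 * (C₃ + 1) * N ^ 2 * kk ^ 2 * (kk + Real.sqrt ρ) ^ 2 := by
        rw [show (A * N * kk * (kk + Real.sqrt ρ)) ^ 2 = A ^ 2 * N ^ 2 * kk ^ 2 * (kk + Real.sqrt ρ) ^ 2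
          by ring, hA2]
      rw [hsq]
      exact this.trans (hstep1.trans hstep3)
    calc Real.sqrt (Q * (2 * N * kk ^ 2 + N * kk ^ 2))
        ≤ Real.sqrt ((A * N * kk * (kk + Real.sqrt ρ)) ^ 2) := Real.sqrt_le_sqrt h3'
      _ = A * N * kk * (kk + Real.sqrt ρ) := Real.sqrt_sq (by positivity)
  set y : ℝ := Real.sqrt nu with hy_def
  have hy2 : y ^ 2 = nu := Real.sq_sqrt hnu
  set G : ℝ := A * N * kk * (kk + Real.sqrt ρ) + N * kk ^ 2 + (C₁ + 1) * (N * Real.sqrt ρ * kk)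
    with hG_def
  have hquad : kk ^ 2 * y ^ 2 ≤ (C₁ * Real.sqrt N * kk ^ 2) * y + G := by
    have habs : kk ^ 2 * nu ≤ |μ| + |μ - kk ^ 2 * nu| := by
      linarith [le_abs_self μ, neg_le_abs (μ - kk ^ 2 * nu)]
    rw [hy2]
    nlinarith [habs, h1, h2, hsqrt]
  have hysq := sq_le_of_quadratic_red (by positivity : 0 < kk ^ 2) hquad
  have hnu_le : nu ≤ C₁ ^ 2 * N + 2 * G / kk ^ 2 := by
    rw [← hy2]
    have : (C₁ * Real.sqrt N * kk ^ 2 / kk ^ 2) ^ 2 = C₁ ^ 2 * N := by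
      rw [mul_div_assoc, div_self (pow_ne_zero 2 hkk.ne'), mul_one, mul_pow, Real.sq_sqrt hNpos.le]
    rw [this] at hysq
    exact hysq
  have hconv1 : (1 : ℝ) ≤ κ * Real.sqrt ρ * L / kinf := by
    rw [le_div_iff₀ hkinf, one_mul]; exact hwin1
  have hconv2 : Real.sqrt ρ / kk ≤ Real.sqrt ρ * L / (2 * Real.pi * kinf) := by
    rw [div_le_div_iff₀ hkk (by positivity)]
    calc Real.sqrt ρ * (2 * Real.pi * kinf) = Real.sqrt ρ * (2 * Real.pi * kinf / L) * L := by
          field_simp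
      _ ≤ Real.sqrt ρ * kk * L := by gcongr
      _ = Real.sqrt ρ * L * kk := by ring
  have hGdiv : 2 * G / kk ^ 2 = 2 * A * N + 2 * N + (2 * A + 2 * C₁ + 2) * N * (Real.sqrt ρ / kk) := by
    rw [hG_def]; field_simp; ring
  have hfinal : nu + np ≤ (2 * C₁ ^ 2 + 2 * A + 3 + C₄) * N * 1 +
      (2 * A + 2 * C₁ + 2) * N * (Real.sqrt ρ * L / (2 * Real.pi * kinf)) := by
    have hc : (2 * A + 2 * C₁ + 2) * N * (Real.sqrt ρ / kk) ≤
        (2 * A + 2 * C₁ + 2) * N * (Real.sqrt ρ * L / (2 * Real.pi * kinf)) :=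
      mul_le_mul_of_nonneg_left hconv2 (by positivity)
    have hC1N : 0 ≤ C₁ ^ 2 * N := by positivity
    have hAN : 0 ≤ A * N := by positivity
    rw [hGdiv] at hnu_le
    linarith [hnu_le, h4, hc, hC1N, hAN]
  have hone : (2 * C₁ ^ 2 + 2 * A + 3 + C₄) * N * 1 ≤
      (2 * C₁ ^ 2 + 2 * A + 3 + C₄) * N * (κ * Real.sqrt ρ * L / kinf) :=
    mul_le_mul_of_nonneg_left hconv1 (by positivity)
  calc nu + np ≤ (2 * C₁ ^ 2 + 2 * A + 3 + C₄) * N * (κ * Real.sqrt ρ * L / kinf) +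
        (2 * A + 2 * C₁ + 2) * N * (Real.sqrt ρ * L / (2 * Real.pi * kinf)) := by linarith
    _ = ((2 * C₁ ^ 2 + 2 * A + 3 + C₄) * κ + (2 * A + 2 * C₁ + 2) / (2 * Real.pi)) * N *
          Real.sqrt ρ * L / kinf := by
        field_simp

end Lemmas

/-! ## The reshape S4 ↦ S4′: the sign of the condensate pairing amplitude suffices -/

section PairingSign

variable {n : ℕ} {L : ℝ}

/-- Polarisation for the two condensate-leg transfers (continuous `(n+1)`-body `Ψ`):
`‖U_kΨ‖² = ‖T_{k0}Ψ‖² + ‖T_{0,−k}Ψ‖² − 2Re⟨T_{k0}Ψ, T_{0,−k}Ψ⟩`. [folklore] -/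
theorem toReal_normSq_phaseUp_eq (k : Fin 3 → ℤ) {Ψ : Config (n + 1) → ℂ} (hΨ : Continuous Ψ) :
    (normSq L (phaseUp L k Ψ)).toReal = (normSq L (transfer L k 0 Ψ)).toReal +
      (normSq L (transfer L 0 (-k) Ψ)).toReal - 2 * innerRe L (transfer L k 0 Ψ) (transfer L 0 (-k) Ψ) := by
  have h1 := continuous_transfer L k 0 hΨ
  have h2 := continuous_transfer L 0 (-k) hΨ
  have hU : Continuous (phaseUp L k Ψ) := continuous_phaseUp L k hΨ
  have h12 : Continuous (fun X => transfer L k 0 Ψ X - transfer L 0 (-k) Ψ X) := h1.sub h2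
  rw [← innerRe_self hU, phaseUp_eq, innerRe_sub_left (h := fun X => transfer L k 0 Ψ X - transfer L 0 (-k) Ψ X)
    h1 h2 h12, innerRe_sub_right h1 h1 h2, innerRe_sub_right h2 h1 h2, innerRe_self h1, innerRe_self h2,
    innerRe_comm L (transfer L 0 (-k) Ψ)]
  ring

/-- Polarisation: `‖P_kΨ‖² = ‖T_{k0}Ψ‖² + ‖T_{0,−k}Ψ‖² + 2Re⟨T_{k0}Ψ, T_{0,−k}Ψ⟩`. [folklore] -/
theorem toReal_normSq_condUp_eq (k : Fin 3 → ℤ) {Ψ : Config (n + 1) → ℂ} (hΨ : Continuous Ψ) :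
    (normSq L (condUp L k Ψ)).toReal = (normSq L (transfer L k 0 Ψ)).toReal +
      (normSq L (transfer L 0 (-k) Ψ)).toReal + 2 * innerRe L (transfer L k 0 Ψ) (transfer L 0 (-k) Ψ) := by
  have h1 := continuous_transfer L k 0 hΨ
  have h2 := continuous_transfer L 0 (-k) hΨ
  have hP : Continuous (condUp L k Ψ) := by rw [condUp_eq]; exact h1.add h2
  have h12 : Continuous (fun X => transfer L k 0 Ψ X + transfer L 0 (-k) Ψ X) := h1.add h2
  rw [← innerRe_self hP, condUp_eq, innerRe_add_left (h := fun X => transfer L k 0 Ψ X + transfer L 0 (-k) Ψ X)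
    h1 h2 h12, innerRe_add_right h1 h1 h2, innerRe_add_right h2 h1 h2, innerRe_self h1, innerRe_self h2,
    innerRe_comm L (transfer L 0 (-k) Ψ)]
  ring

end PairingSign

/-- **S4 ⇒ S4′**: `2Re⟨T_{k0}Ψ, T_{0,−k}Ψ⟩ = ‖P_kΨ‖² − ‖T_{k0}Ψ‖² − ‖T_{0,−k}Ψ‖² ≤ ‖P_kΨ‖²`, so the density-quadrature
bound gives the pairing-sign bound with the same constant. [folklore] -/
theorem condensatePairingSign_of_densityQuadrature (h4 : CondensateDensityQuadrature) : CondensatePairingSign := by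
  intro R₀ V₁ hR₀ hV₁ κ hκ
  obtain ⟨ρ₀, hρ₀, C, hC, H4⟩ := h4 R₀ V₁ hR₀ hV₁ κ hκ
  refine ⟨ρ₀, hρ₀, C, hC, fun ρ hρ hρlt => ?_⟩
  filter_upwards [H4 ρ hρ hρlt, eventually_gt_atTop 0] with N HN hNpos
  intro w hw hE k hk ε hε
  obtain ⟨δ, hδ, P4⟩ := HN w hw hE k hk ε hε
  refine ⟨δ, hδ, fun Ψ hΨ => ?_⟩
  have h := P4 Ψ hΨ
  obtain ⟨n, rfl⟩ : ∃ n, N = n + 1 := ⟨N - 1, by omega⟩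
  have hΨc : Continuous Ψ.ψ := Ψ.contDiff.continuous
  rw [toReal_normSq_condUp_eq k hΨc] at h
  have h1 : 0 ≤ (normSq (sideLength ρ (n + 1)) (transfer (sideLength ρ (n + 1)) k 0 Ψ.ψ)).toReal :=
    ENNReal.toReal_nonneg
  have h2 : 0 ≤ (normSq (sideLength ρ (n + 1)) (transfer (sideLength ρ (n + 1)) 0 (-k) Ψ.ψ)).toReal :=
    ENNReal.toReal_nonneg
  have hCN : 0 ≤ C * ((n + 1 : ℕ) : ℝ) := by positivity
  linarith

/-- **S1 ∧ S4′ ⇒ `WeightedClassBound R₀ V₁`** (S2, S3 landed): the composition algebra with the S4-slot fed by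
`np := ‖T_{k0}Ψ‖² + ‖T_{0,−k}Ψ‖² − ‖U_kΨ‖² = 2Re⟨T_{k0}Ψ,T_{0,−k}Ψ⟩ ≤ 2CN + N` gives `‖T_{k0}Ψ‖² + ‖T_{0,−k}Ψ‖² ≤ C_w N√ρL/‖k‖_∞`,
and `‖U_kΨ‖² + ‖P_kΨ‖² = 2(‖T_{k0}Ψ‖² + ‖T_{0,−k}Ψ‖²)` (parallelogram). [folklore] -/
theorem weightedClassBound_of_pairingSign (h1 : BackflowBound) (h4' : CondensatePairingSign)
    {R₀ V₁ : ℝ} (hR₀ : 0 < R₀) (hV₁ : 0 ≤ V₁) : WeightedClassBound R₀ V₁ := by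
  intro κ hκ
  obtain ⟨ρ₁, hρ₁, C₁, hC₁, H1⟩ := h1 R₀ V₁ hR₀ hV₁ κ hκ
  obtain ⟨ρ₃, hρ₃, C₃, hC₃, H3⟩ := stub_phaseDoubleCommutator R₀ V₁ hR₀ hV₁ κ hκ
  obtain ⟨ρ₄, hρ₄, C₄, hC₄, H4⟩ := h4' R₀ V₁ hR₀ hV₁ κ hκ
  have hC₄' : 0 < 2 * C₄ := by positivity
  set Cw : ℝ := (2 * C₁ ^ 2 + 2 * Real.sqrt (3 * (C₃ + 1)) + 3 + 2 * C₄) * κ +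
      (2 * Real.sqrt (3 * (C₃ + 1)) + 2 * C₁ + 2) / (2 * Real.pi) with hCw
  have hCwpos : 0 < Cw := by positivity
  refine ⟨min ρ₁ (min ρ₃ ρ₄), lt_min hρ₁ (lt_min hρ₃ hρ₄), 2 * Cw, by positivity, fun ρ hρ hρlt => ?_⟩
  have hρ1 : ρ < ρ₁ := hρlt.trans_le (min_le_left _ _)
  have hρ3 : ρ < ρ₃ := hρlt.trans_le ((min_le_right _ _).trans (min_le_left _ _))
  have hρ4 : ρ < ρ₄ := hρlt.trans_le ((min_le_right _ _).trans (min_le_right _ _))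
  filter_upwards [H1 ρ hρ hρ1, H3 ρ hρ hρ3, H4 ρ hρ hρ4, eventually_gt_atTop 0] with N HN1 HN3 HN4 hNpos
  intro w hw hE k hk
  have hL : 0 < sideLength ρ N := sideLength_pos_of_pos hρ hNpos
  have hk0 : k ≠ 0 := hk.1
  have hkk : 0 < ‖waveVector (sideLength ρ N) k‖ := norm_waveVector_pos_red hL hk0
  have hkinf : 0 < ‖(fun j => (k j : ℝ))‖ := lt_of_lt_of_le one_pos (one_le_norm_intVec hk0)
  have hwfr : IsRepulsiveFiniteRange w := ⟨hw.1, R₀, hw.2.1⟩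
  have hwint : (∫⁻ x : Space, w ‖x‖) ≠ ⊤ := ne_top_of_le_ne_top ENNReal.ofReal_ne_top hw.2.2
  have hNr : (1 : ℝ) ≤ N := by exact_mod_cast hNpos
  have hNr' : (0 : ℝ) < N := by exact_mod_cast hNpos
  obtain ⟨δ₁, hδ₁, P1⟩ :=
    HN1 w hw hE k hk (N * Real.sqrt ρ * ‖waveVector (sideLength ρ N) k‖) (by positivity)
  obtain ⟨δ₂, hδ₂, P2⟩ := stub_phaseConeBlock w hwfr hwint N (sideLength ρ N) hL hE k hk0
    (N * ‖waveVector (sideLength ρ N) k‖ ^ 2) (by positivity)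
  obtain ⟨δ₃, hδ₃, P3⟩ := HN3 w hw hE k hk (N * ρ) (by positivity)
  obtain ⟨δ₄, hδ₄, P4⟩ := HN4 w hw hE k hk (N / 2) (by positivity)
  refine ⟨min δ₁ (min δ₂ (min δ₃ δ₄)), lt_min hδ₁ (lt_min hδ₂ (lt_min hδ₃ hδ₄)), fun Ψ hΨ => ?_⟩
  have hΨ1 : NearMin w ρ N δ₁ Ψ := nearMin_mono_red hΨ (min_le_left _ _)
  have hΨ2 : NearMin w ρ N δ₂ Ψ := nearMin_mono_red hΨ ((min_le_right _ _).trans (min_le_left _ _))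
  have hΨ3 : NearMin w ρ N δ₃ Ψ :=
    nearMin_mono_red hΨ ((min_le_right _ _).trans ((min_le_right _ _).trans (min_le_left _ _)))
  have hΨ4 : NearMin w ρ N δ₄ Ψ :=
    nearMin_mono_red hΨ ((min_le_right _ _).trans ((min_le_right _ _).trans (min_le_right _ _)))
  obtain ⟨n, rfl⟩ : ∃ n, N = n + 1 := ⟨N - 1, by omega⟩
  have hΨc : Continuous Ψ.ψ := Ψ.contDiff.continuous
  -- the S4-slot: np := ‖T₁‖² + ‖T₂‖² − ‖U‖² = 2 Re⟨T₁, T₂⟩ ≤ 2 C₄ N + N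
  set T1 : ℝ := (normSq (sideLength ρ (n + 1)) (transfer (sideLength ρ (n + 1)) k 0 Ψ.ψ)).toReal with hT1
  set T2 : ℝ := (normSq (sideLength ρ (n + 1)) (transfer (sideLength ρ (n + 1)) 0 (-k) Ψ.ψ)).toReal with hT2
  set nu : ℝ := (normSq (sideLength ρ (n + 1)) (phaseUp (sideLength ρ (n + 1)) k Ψ.ψ)).toReal with hnu
  have hpolU := toReal_normSq_phaseUp_eq (L := sideLength ρ (n + 1)) k hΨc
  have hpolP := toReal_normSq_condUp_eq (L := sideLength ρ (n + 1)) k hΨc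
  have hnp : T1 + T2 - nu ≤ 2 * C₄ * ((n + 1 : ℕ) : ℝ) + ((n + 1 : ℕ) : ℝ) := by
    have h4 := P4 Ψ hΨ4
    rw [hT1, hT2, hnu, hpolU]
    linarith
  have key := weighted_algebra_red hNr hρ hkk hL hkinf hκ hC₁ hC₃ hC₄' ENNReal.toReal_nonneg hk.2
    (two_pi_mul_norm_div_le_norm_waveVector_red hL k) (P1 Ψ hΨ1) (P2 Ψ hΨ2) (P3 Ψ hΨ3) hnp
  -- ‖U‖² + ‖P‖² = 2 (T1 + T2)
  have hsum : nu + (normSq (sideLength ρ (n + 1)) (condUp (sideLength ρ (n + 1)) k Ψ.ψ)).toReal =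
      2 * (T1 + T2) := by
    rw [hnu, hpolU, hpolP]; ring
  have hfin : nu + (T1 + T2 - nu) = T1 + T2 := by ring
  rw [hfin] at key
  calc nu + (normSq (sideLength ρ (n + 1)) (condUp (sideLength ρ (n + 1)) k Ψ.ψ)).toReal
      = 2 * (T1 + T2) := hsum
    _ ≤ 2 * (Cw * ((n + 1 : ℕ) : ℝ) * Real.sqrt ρ * sideLength ρ (n + 1) / ‖(fun j => (k j : ℝ))‖) := by
        linarith
    _ = 2 * Cw * ((n + 1 : ℕ) : ℝ) * Real.sqrt ρ * sideLength ρ (n + 1) / ‖(fun j => (k j : ℝ))‖ := by ring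

/-- **S1 ∧ S4′ ∧ S5a ⇒ the crux's infrared bound for every INTEGRABLE admissible potential** (S2, S3, S5 landed).
[folklore] -/
theorem irBoundFor_integrable_of_pairingSign (h1 : BackflowBound) (h4' : CondensatePairingSign)
    (h5a : CondensateNumberVariance) :
    ∀ v : ℝ → ℝ≥0∞, IsRepulsiveFiniteRange v → (∫⁻ x : Space, v ‖x‖) ≠ ⊤ → IRBoundFor v := by
  intro v hv htop
  obtain ⟨R, hR⟩ := hv.2
  have hR₀ : (0 : ℝ) < max R 1 := lt_max_of_lt_right one_pos
  have hV₁ : (0 : ℝ) ≤ (∫⁻ x : Space, v ‖x‖).toReal := ENNReal.toReal_nonneg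
  have hcls : InClass (max R 1) (∫⁻ x : Space, v ‖x‖).toReal v :=
    ⟨hv.1, fun r hr => hR r ((le_max_left _ _).trans_lt hr), by rw [ENNReal.ofReal_toReal htop]⟩
  exact stub_normalisationBootstrap _ _ hR₀ hV₁ (h5a _ _ hR₀ hV₁)
    (weightedClassBound_of_pairingSign h1 h4' hR₀ hV₁) v hcls

/-- **The same from the STATIC backflow-current bound** in place of S1. [folklore] -/
theorem irBoundFor_integrable_of_static_pairingSign (hS : StaticBackflowCurrent) (h4' : CondensatePairingSign)
    (h5a : CondensateNumberVariance) :
    ∀ v : ℝ → ℝ≥0∞, IsRepulsiveFiniteRange v → (∫⁻ x : Space, v ‖x‖) ≠ ⊤ → IRBoundFor v :=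
  irBoundFor_integrable_of_pairingSign (stub_backflowOfStatic hS) h4' h5a

/-- **S1 ∧ S4′ ∧ S5a ∧ S6 ⇒ the crux `PeriodicIRBound` BY NAME** (S2, S3, S5 landed). [folklore] -/
theorem periodicIRBound_of_pairingSign (h1 : BackflowBound) (h4' : CondensatePairingSign)
    (h5a : CondensateNumberVariance) (h6 : NonIntegrableHalf) : PeriodicIRBound := by
  refine periodicIRBound_iff.mpr fun v hv => ?_
  by_cases htop : (∫⁻ x : Space, v ‖x‖) = ⊤
  · exact h6 v hv htop
  · exact irBoundFor_integrable_of_pairingSign h1 h4' h5a v hv htop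

/-! ## The original S4 route as corollaries (S4 ⇒ S4′) -/

/-- **S1 ∧ S4 ⇒ `WeightedClassBound R₀ V₁`** (through S4 ⇒ S4′). [folklore] -/
theorem weightedClassBound_of_open_inputs (h1 : BackflowBound) (h4 : CondensateDensityQuadrature)
    {R₀ V₁ : ℝ} (hR₀ : 0 < R₀) (hV₁ : 0 ≤ V₁) : WeightedClassBound R₀ V₁ :=
  weightedClassBound_of_pairingSign h1 (condensatePairingSign_of_densityQuadrature h4) hR₀ hV₁

/-- **S1 ∧ S4 ∧ S5a ⇒ the crux's infrared bound for every INTEGRABLE admissible potential.** [folklore] -/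
theorem irBoundFor_integrable_of_open_inputs (h1 : BackflowBound) (h4 : CondensateDensityQuadrature)
    (h5a : CondensateNumberVariance) :
    ∀ v : ℝ → ℝ≥0∞, IsRepulsiveFiniteRange v → (∫⁻ x : Space, v ‖x‖) ≠ ⊤ → IRBoundFor v :=
  irBoundFor_integrable_of_pairingSign h1 (condensatePairingSign_of_densityQuadrature h4) h5a

/-- **The same from the STATIC backflow-current bound** in place of S1. [folklore] -/
theorem irBoundFor_integrable_of_static (hS : StaticBackflowCurrent) (h4 : CondensateDensityQuadrature)
    (h5a : CondensateNumberVariance) :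
    ∀ v : ℝ → ℝ≥0∞, IsRepulsiveFiniteRange v → (∫⁻ x : Space, v ‖x‖) ≠ ⊤ → IRBoundFor v :=
  irBoundFor_integrable_of_open_inputs (stub_backflowOfStatic hS) h4 h5a

/-- **S1 ∧ S4 ∧ S5a ∧ S6 ⇒ the crux `PeriodicIRBound` BY NAME.** [folklore] -/
theorem periodicIRBound_of_open_inputs (h1 : BackflowBound) (h4 : CondensateDensityQuadrature)
    (h5a : CondensateNumberVariance) (h6 : NonIntegrableHalf) : PeriodicIRBound :=
  periodicIRBound_of_pairingSign h1 (condensatePairingSign_of_densityQuadrature h4) h5a h6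

/-- **Registered by-product sub-goal `stub_fsumReduction`** of the crux ledger (line `fsum-phase-pencil`, seat c8):
the standing reduction after the reshape — the integrable class from S1 ∧ S4′ ∧ S5a, the crux by name from
S1 ∧ S4′ ∧ S5a ∧ S6, and S4 ⇒ S4′. [folklore] -/
theorem stub_fsumReduction : (BackflowBound → CondensatePairingSign → CondensateNumberVariance → ∀ v : ℝ → ℝ≥0∞, IsRepulsiveFiniteRange v → (∫⁻ x : Space, v ‖x‖) ≠ ⊤ → IRBoundFor v) ∧ (BackflowBound → CondensatePairingSign → CondensateNumberVariance → NonIntegrableHalf → PeriodicIRBound) ∧ (CondensateDensityQuadrature → CondensatePairingSign) :=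
  ⟨irBoundFor_integrable_of_pairingSign, periodicIRBound_of_pairingSign, condensatePairingSign_of_densityQuadrature⟩

end Summit.AtomisticToContinuum.BoseEinsteinCondensation.Cruxes.PeriodicIRBound.FsumPhasePencil

end
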